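import Literature.NumberTheory.Automorphic.SelfDualStableLatticeDepthCountFrames        -- ★ A-p13 FILES 1–3: level ∕ depth counts (normalised frame), transport, finiteness
import Literature.NumberTheory.Automorphic.UniformizerModularStableLatticeCount         -- ★ A-p03: `exists_ncard_modularStable_eq_smul_one` pattern, `setOf_modularStable_eq_selfDualStable`
import Literature.NumberTheory.Rogawski1990.UnitStableOrbitalIntegralHSideValue          -- ★ B-p10: `ncard_selfDualStable_zpow_smul_one_eq_sum_at` (the inert discharges), CM transport
import HarnessLib

/-!
# DEPTH COUNTS AT THE CM PLACE `w` (road «R1LL-tree», (α) LAYER 2-A): the cumulative level-`i` counts of the `γ`-fixed self-dual and ϖ-modular vertices of the tree of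
# `U(Φ₂)_v` for `γ ∈ U(σ_w, (Φ₂)_w)(L_w)` regular elliptic, and the finiteness of both vertex sets (Flicker 1998 §6 p. 95; Kottwitz 1988 §2)

Topic `NumberTheory/Automorphic`; namespace `Literature.NumberTheory.Automorphic.UnitaryGroup` (that of ★ `SelfDualLatticeCountFrameTransportCM`).  THEOREMS ONLY (no definition,
no instance, no notation, no named fact, no `sorry`).  Cell `pub/hodgecm-mathlib`, F0∕P3a road «R1LL-tree» (architect A-p16 (g27) RULINGS A-2 (a), A-4 (a)(c), A-8 (c)), hand
A-p13 (g31); fourth file of the I-2 «depth counts» brick.  HC_CM is proved only modulo the printed citations until rung 0 closes; nothing printed is a letter here.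

SETTING.  `v` a finite place of `L⁺` UNRAMIFIED and non-split in the CM field `L` (`w ∣ v`, `c • w = w`), `σ_w = galAdicCompletionMap c hw`, `ϖ_w := ι_w(ϖ_v)` (a `σ_w`-fixed
uniformizer of `L_w`, ★ `valued_toPlace_uniformizer`), `q_v := |𝓞_{L⁺} ∕ v|` (`|𝓀_w| = q_v²`), `(Φ₂)_w = placeForm Φ₂ w.1`; `γ ∈ U(σ_w, (Φ₂)_w)` with an eigenframe
`γ P = P · diag(u)`, `u₀ ≠ u₁` of norm one, `|u₀ − u₁|_w = |ϖ_w^N|`.  The parity bit `e ∈ {0,1}` is that of ★ (L5-d1): `Even (log |⟨p₀, p₀⟩|) ↔ e = 0` (self-dual side) ∕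
`↔ e = 1` (ϖ-modular side, ★ A-p03) — the TYPE of the vertex fixed by the torus.

* §1 `exists_integer_involution_of_isUnramifiedIn` — the inert discharge package of ★ `ncard_selfDualStable_zpow_smul_one_eq_sum_at` as ONE existential
  (`σO : 𝒪 →+* 𝒪` restricting `σ_w`, an involution, moving some `a₀` by a unit; `|𝓀_w| = q_v²`); `coe_inv_mul_mul_eq_of_eigenframe` (`↑((PD)⁻¹γ(PD)) = !![u₀, 0; 0, u₁]`).
* §2 **`exists_ncard_selfDualStable_antidiagTwo_level_eq_sum_at`**: `∃ e ≤ 1, (Even … ↔ e = 0) ∧ #{Λ ∈ S((Φ₂)_w, γ) | (γ − u₁·1)Λ ≤ ϖ_w^iΛ} = Σ_{j ≤ N, j ≡ e, j + i ≤ N} w(q_v, j)`;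
  `finite_selfDualStable_antidiagTwo_at`.
* §3 **`exists_ncard_modularStable_antidiagTwo_level_eq_sum_at`** (`↔ e = 1`, same sum); `finite_modularStable_antidiagTwo_at`.

## References
* [Flicker1998UnitaryFL] Y. Z. Flicker, *Elementary proof of the fundamental lemma for a unitary group*, Canad. J. Math. 50 (1998), §6 p. 95 + REMARK.
* [Kottwitz1988] R. E. Kottwitz, *Tamagawa numbers*, Ann. of Math. 127 (1988), §2.
* [Rogawski1990] J. D. Rogawski, *Automorphic Representations of Unitary Groups in Three Variables* (1990), §4.9 Lemma 4.9.3 p. 56; [Serre1979] *Local Fields*, Ch. V §2 Prop. 3.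
-/

set_option autoImplicit false

noncomputable section

open NumberField IsDedekindDomain Matrix Finset ValuativeRel
open scoped ValuativeRel Matrix MatrixGroups

namespace Literature.NumberTheory.Automorphic

/-! ## §0 Generic frame lemmas (normalised count read through a rescaled eigenframe `Q = P·D`) -/

section OfFrame

variable {F : Type*} [Field F] [ValuativeRel F] (σ : F →+* F) {ϖ : F} (hϖ : IsUniformizingElement ϖ)
  (σO : 𝒪[F] →+* 𝒪[F]) (hσO' : ∀ x : 𝒪[F], ((σO x : 𝒪[F]) : F) = σ x) (hσσ : ∀ x, σO (σO x) = x)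
  (hσϖ : σ ϖ = ϖ) {e : ℕ} (he : e ≤ 1) {a c : F} {N : ℕ} (J : Matrix (Fin 2) (Fin 2) F) (γ Q : GL (Fin 2) F)
  (hQγ : ((Q⁻¹ * γ * Q : GL (Fin 2) F) : Matrix (Fin 2) (Fin 2) F) = !![a, 0; 0, c])
  (ha : valuation F a = 1) (hc : valuation F c = 1) (hN : valuation F (a - c) = valuation F (ϖ ^ N))

include hϖ hσO' hσσ hσϖ he hQγ ha hc hN in
/-- **The ϖ-modular level count through a frame**: if `ᵗσ(Q)(ϖ⁻¹J)Q = ϖ^e • 1` and `Q⁻¹γQ = diag(a, c)` then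
`#{Λ ∈ M(J, γ) | (γ − c·1)Λ ≤ ϖ^iΛ} = Σ_{j ≤ N, j ≡ e, j + i ≤ N} w(j)` (★ FILE 2 dictionary + transport, ★ FILE 1 count). [cite: Kottwitz1988, §2] -/
theorem ncard_modularStable_level_eq_sum_of_frame [IsDiscreteValuationRing 𝒪[F]] [Finite (IsLocalRing.ResidueField 𝒪[F])]
    [IsAdicComplete (IsLocalRing.maximalIdeal 𝒪[F]) 𝒪[F]] {a₀ : 𝒪[F]} (ha₀ : IsUnit (σO a₀ - a₀)) {q : ℕ}
    (hq : Nat.card (IsLocalRing.ResidueField 𝒪[F]) = q ^ 2)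
    (hform : formCongr σ Q (ϖ⁻¹ • J) = (ϖ ^ (e : ℤ)) • (1 : Matrix (Fin 2) (Fin 2) F)) (i : ℕ) :
    {Λ : Submodule 𝒪[F] (Fin 2 → F) |
        ((∃ g : GL (Fin 2) F, (∃ J' ∈ glInt 2 F, ϖ • (J' : Matrix (Fin 2) (Fin 2) F) = formCongr σ g J) ∧
            Λ = Submodule.span 𝒪[F] (Set.range ((g : Matrix (Fin 2) (Fin 2) F))ᵀ)) ∧
          Λ.map ((Matrix.toLin' ((γ : GL (Fin 2) F) : Matrix (Fin 2) (Fin 2) F)).restrictScalars 𝒪[F]) = Λ) ∧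
        Λ.map ((Matrix.toLin' (((γ : GL (Fin 2) F) : Matrix (Fin 2) (Fin 2) F) - c • (1 : Matrix (Fin 2) (Fin 2) F))).restrictScalars 𝒪[F]) ≤
          Λ.map ((Matrix.toLin' (ϖ ^ i • (1 : Matrix (Fin 2) (Fin 2) F))).restrictScalars 𝒪[F])}.ncard =
      ∑ j ∈ (range (N + 1)).filter (fun j => j % 2 = e ∧ j + i ≤ N), (if j = 0 then 1 else q ^ (j - 1) * (q + 1)) := by
  rw [setOf_modularStable_and_eq_selfDualStable_and σ hϖ.ne_zero J γ, ncard_selfDualStable_level_congr σ (ϖ⁻¹ • J) γ Q c (ϖ ^ i), hform]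
  exact ncard_selfDualStable_smul_one_diag_level_self_eq_sum hϖ σO hσO' hσσ hσϖ he _ hQγ ha hc hN ha₀ hq i

include hϖ hσO' hσσ hσϖ he hQγ ha hc hN in
/-- **Finiteness of `M(J, γ)` through a frame** (same hypotheses; ★ FILE 3 `finite_selfDualStable_of_congr` + ★ FILE 2 `finite_selfDualStable_smul_one_diag`).
[cite: Kottwitz1988, §2] -/
theorem finite_modularStable_of_frame [IsDiscreteValuationRing 𝒪[F]] [Finite (IsLocalRing.ResidueField 𝒪[F])]
    [IsAdicComplete (IsLocalRing.maximalIdeal 𝒪[F]) 𝒪[F]] {a₀ : 𝒪[F]} (ha₀ : IsUnit (σO a₀ - a₀)) {q : ℕ}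
    (hq : Nat.card (IsLocalRing.ResidueField 𝒪[F]) = q ^ 2)
    (hform : formCongr σ Q (ϖ⁻¹ • J) = (ϖ ^ (e : ℤ)) • (1 : Matrix (Fin 2) (Fin 2) F)) :
    {Λ : Submodule 𝒪[F] (Fin 2 → F) |
        (∃ g : GL (Fin 2) F, (∃ J' ∈ glInt 2 F, ϖ • (J' : Matrix (Fin 2) (Fin 2) F) = formCongr σ g J) ∧
            Λ = Submodule.span 𝒪[F] (Set.range ((g : Matrix (Fin 2) (Fin 2) F))ᵀ)) ∧
          Λ.map ((Matrix.toLin' ((γ : GL (Fin 2) F) : Matrix (Fin 2) (Fin 2) F)).restrictScalars 𝒪[F]) = Λ}.Finite := by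
  rw [setOf_modularStable_eq_selfDualStable σ hϖ.ne_zero J γ]
  refine finite_selfDualStable_of_congr σ _ γ Q ?_
  rw [hform]
  exact finite_selfDualStable_smul_one_diag σ hϖ σO hσO' hσσ hσϖ he _ hQγ ha hc hN ha₀ hq

end OfFrame

end Literature.NumberTheory.Automorphic

namespace Literature.NumberTheory.Automorphic.UnitaryGroup

open Literature.NumberTheory.Rogawski1990 Literature.NumberTheory.GaloisRepresentations

variable (L : Type) [Field L] [NumberField L] [IsCMField L] (v : HeightOneSpectrum (𝓞 ↥(maximalRealSubfield L)))
  (w : PlacesOver L v) (hw : IsCMField.complexConj L • w.1 = w.1)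

/-! ## §1 The inert discharge package and frame bookkeeping -/

section Package

include hw in
/-- **THE INERT DISCHARGE PACKAGE** at a place `v` unramified and non-split in `L`: `σ_w` restricts to a ring involution `σO` of `𝒪[L_w]` which moves some `a₀ ∈ 𝒪` by a UNIT
(`σ̄_w = Frob_{q_v} ≠ id` on `𝓀_w`), and `|𝓀_w| = q_v²` — the hypotheses `σO hσO' hσσ ha₀ hq` of the normalised counts ★ (L5-d3) ∕ ★ FILES 1–3, exactly as discharged inside ★
`ncard_selfDualStable_zpow_smul_one_eq_sum_at`. [cite: Serre1979, Ch. V §2 Prop. 3] [cite: Flicker1998UnitaryFL, §6 p. 95 REMARK] -/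
theorem exists_integer_involution_of_isUnramifiedIn (hunr : Algebra.IsUnramifiedIn (𝓞 L) v.asIdeal) :
    ∃ (σO : 𝒪[w.1.adicCompletion L] →+* 𝒪[w.1.adicCompletion L]) (a₀ : 𝒪[w.1.adicCompletion L]),
      (∀ x : 𝒪[w.1.adicCompletion L], ((σO x : 𝒪[w.1.adicCompletion L]) : w.1.adicCompletion L) =
        galAdicCompletionMap (L := L) (IsCMField.complexConj L) hw x) ∧
      (∀ x, σO (σO x) = x) ∧ IsUnit (σO a₀ - a₀) ∧
      Nat.card (IsLocalRing.ResidueField 𝒪[w.1.adicCompletion L]) = Nat.card (𝓞 ↥(maximalRealSubfield L) ⧸ v.asIdeal) ^ 2 := by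
  classical
  have hc1 : IsCMField.complexConj L ≠ 1 := IsCMField.complexConj_ne_one L
  have hσO : ∀ x : 𝒪[w.1.adicCompletion L], galAdicCompletionMap (L := L) (IsCMField.complexConj L) hw x ∈ 𝒪[w.1.adicCompletion L] :=
    mem_integer_galAdicCompletionMap (IsCMField.complexConj L) v w hw
  let σO : 𝒪[w.1.adicCompletion L] →+* 𝒪[w.1.adicCompletion L] :=
    ((galAdicCompletionMap (L := L) (IsCMField.complexConj L) hw).comp (𝒪[w.1.adicCompletion L]).subtype).codRestrict 𝒪[w.1.adicCompletion L] fun x => hσO x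
  have hσO' : ∀ x : 𝒪[w.1.adicCompletion L], ((σO x : 𝒪[w.1.adicCompletion L]) : w.1.adicCompletion L) =
      galAdicCompletionMap (L := L) (IsCMField.complexConj L) hw x := fun _ => rfl
  have hσσ : ∀ x, σO (σO x) = x := fun x =>
    Subtype.ext (galAdicCompletionMap_galAdicCompletionMap_of_smul_eq (IsCMField.complexConj L) w hc1 hw (x : w.1.adicCompletion L))
  obtain ⟨σk, hσk⟩ := exists_residueField_ringHom_galAdicCompletionMap (IsCMField.complexConj L) v w hw
  have hq : Nat.card 𝓀[w.1.adicCompletion L] = Nat.card (𝓞 ↥(maximalRealSubfield L) ⧸ v.asIdeal) ^ 2 :=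
    natCard_residueField_eq_sq_of_inert (IsCMField.complexConj L) v hc1 hunr w hw
  letI : Fintype 𝓀[w.1.adicCompletion L] := Fintype.ofFinite _
  have hq' : Fintype.card 𝓀[w.1.adicCompletion L] = Nat.card (𝓞 ↥(maximalRealSubfield L) ⧸ v.asIdeal) ^ 2 := by rw [← Nat.card_eq_fintype_card, hq]
  obtain ⟨a₀, ha₀⟩ := LocalFields.UnramifiedQuadraticNorm.exists_isUnit_map_sub_of_residueHom_ne
    (galAdicCompletionMap (L := L) (IsCMField.complexConj L) hw) hσO σk hσk
    (Literature.LinearAlgebra.Matrix.exists_frob_ne hq' σk (residueHom_galAdicCompletionMap_eq_pow (IsCMField.complexConj L) v hc1 hunr w hw σk hσO hσk))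
  exact ⟨σO, a₀, hσO', hσσ, ha₀, hq⟩

omit [IsCMField L] in
/-- `diagonal u = !![u₀, 0; 0, u₁]` (matrix bookkeeping). [folklore] -/
private theorem diagonal_eq_fin_two_at (u : Fin 2 → w.1.adicCompletion L) :
    (diagonal u : Matrix (Fin 2) (Fin 2) (w.1.adicCompletion L)) = !![u 0, 0; 0, u 1] := by
  ext i j
  fin_cases i <;> fin_cases j <;> simp [Matrix.diagonal]

omit [IsCMField L] in
/-- **The rescaled eigenframe conjugates `γ` to `!![u₀, 0; 0, u₁]`** (★ (L5-d1) `inv_mul_mul_eq_diagonal_of_eigenframe`). [cite: Rogawski1990, §4.9 Lemma 4.9.3 p. 56] -/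
theorem coe_inv_mul_mul_eq_of_eigenframe {γ P D : GL (Fin 2) (w.1.adicCompletion L)} {u c : Fin 2 → w.1.adicCompletion L}
    (hP : (γ : Matrix (Fin 2) (Fin 2) (w.1.adicCompletion L)) * P = P * diagonal u) (hD : (D : Matrix (Fin 2) (Fin 2) (w.1.adicCompletion L)) = diagonal c) :
    (((P * D)⁻¹ * γ * (P * D) : GL (Fin 2) (w.1.adicCompletion L)) : Matrix (Fin 2) (Fin 2) (w.1.adicCompletion L)) = !![u 0, 0; 0, u 1] := by
  rw [inv_mul_mul_eq_diagonal_of_eigenframe γ P D hP hD, diagonal_eq_fin_two_at]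

end Package

/-! ## §2 The self-dual (type `e`) vertices: cumulative level counts at `w`, finiteness -/

section SelfDual

include hw in
/-- **CUMULATIVE LEVEL-`i` COUNT OF THE `γ`-FIXED SELF-DUAL VERTICES AT `w`**: for `γ ∈ U(σ_w, (Φ₂)_w)` with eigenframe `γ P = P · diag(u)` (`u₀ ≠ u₁` of norm one,
`|u₀ − u₁| = |ϖ_w^N|`) there is `e ∈ {0,1}` (the parity of `log |⟨p₀,p₀⟩|`: `Even ↔ e = 0`) with
`#{Λ ∈ S((Φ₂)_w, γ) | (γ − u₁·1)Λ ≤ ϖ_w^iΛ} = Σ_{j ≤ N, j ≡ e (2), j + i ≤ N} w(q_v, j)`, `w(0) = 1`, `w(j) = q_v^{j−1}(q_v+1)` — ★ (L5-d1) frame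
`exists_rescaling_formCongr_eq_uniformizer_pow_smul_one`, ★ FILE 2 `ncard_selfDualStable_level_congr` (the level conjunct rides along), ★ FILE 1
`ncard_selfDualStable_smul_one_diag_level_self_eq_sum` with the §1 package.  On the tree: the type-`e` vertices of the fixed ball at depth `≥ i`.
[cite: Flicker1998UnitaryFL, §6 p. 95 + REMARK] [cite: Kottwitz1988, §2] [cite: Rogawski1990, §4.9 Lemma 4.9.3 p. 56] -/
theorem exists_ncard_selfDualStable_antidiagTwo_level_eq_sum_at (hunr : Algebra.IsUnramifiedIn (𝓞 L) v.asIdeal)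
    {γ P : GL (Fin 2) (w.1.adicCompletion L)} {u : Fin 2 → w.1.adicCompletion L}
    (hγ : γ ∈ Literature.AlgebraicGeometry.ShimuraVarieties.unitaryGroup (galAdicCompletionMap (L := L) (IsCMField.complexConj L) hw)
      (placeForm (Matrix.of fun i j : Fin 2 => if i.val + j.val + 1 = 2 then (1 : L) else 0) w.1))
    (hP : (γ : Matrix (Fin 2) (Fin 2) (w.1.adicCompletion L)) * P = P * diagonal u) (hu : Function.Injective u)
    (hu1 : ∀ i, galAdicCompletionMap (L := L) (IsCMField.complexConj L) hw (u i) * u i = 1) {N : ℕ}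
    (hN : valuation (w.1.adicCompletion L) (u 0 - u 1) =
      valuation (w.1.adicCompletion L) (toPlace v w (HeckeCharacter.uniformizer ↥(maximalRealSubfield L) v : v.adicCompletion ↥(maximalRealSubfield L)) ^ N))
    (i : ℕ) :
    ∃ e : ℕ, e ≤ 1 ∧
      (Even (WithZero.log (Valued.v (twistGram (galAdicCompletionMap (L := L) (IsCMField.complexConj L) hw)
        (placeForm (Matrix.of fun i j : Fin 2 => if i.val + j.val + 1 = 2 then (1 : L) else 0) w.1) P.val 0 0))) ↔ e = 0) ∧
      {Λ : Submodule 𝒪[w.1.adicCompletion L] (Fin 2 → w.1.adicCompletion L) |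
          ((∃ g : GL (Fin 2) (w.1.adicCompletion L),
            (∃ J' ∈ glInt 2 (w.1.adicCompletion L), (J' : Matrix (Fin 2) (Fin 2) (w.1.adicCompletion L)) =
              formCongr (galAdicCompletionMap (L := L) (IsCMField.complexConj L) hw) g
                (placeForm (Matrix.of fun i j : Fin 2 => if i.val + j.val + 1 = 2 then (1 : L) else 0) w.1)) ∧
            Λ = Submodule.span 𝒪[w.1.adicCompletion L] (Set.range ((g : Matrix (Fin 2) (Fin 2) (w.1.adicCompletion L)))ᵀ)) ∧
          Λ.map ((Matrix.toLin' ((γ : GL (Fin 2) (w.1.adicCompletion L)) : Matrix (Fin 2) (Fin 2) (w.1.adicCompletion L))).restrictScalars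
            𝒪[w.1.adicCompletion L]) = Λ) ∧
          Λ.map ((Matrix.toLin' (((γ : GL (Fin 2) (w.1.adicCompletion L)) : Matrix (Fin 2) (Fin 2) (w.1.adicCompletion L)) -
              u 1 • (1 : Matrix (Fin 2) (Fin 2) (w.1.adicCompletion L)))).restrictScalars 𝒪[w.1.adicCompletion L]) ≤
            Λ.map ((Matrix.toLin' (toPlace v w (HeckeCharacter.uniformizer ↥(maximalRealSubfield L) v : v.adicCompletion ↥(maximalRealSubfield L)) ^ i •
              (1 : Matrix (Fin 2) (Fin 2) (w.1.adicCompletion L)))).restrictScalars 𝒪[w.1.adicCompletion L])}.ncard =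
      ∑ j ∈ (range (N + 1)).filter (fun j => j % 2 = e ∧ j + i ≤ N),
        (if j = 0 then 1 else Nat.card (𝓞 ↥(maximalRealSubfield L) ⧸ v.asIdeal) ^ (j - 1) * (Nat.card (𝓞 ↥(maximalRealSubfield L) ⧸ v.asIdeal) + 1)) := by
  classical
  obtain ⟨c, D, e, hD, he1, hpar, hform⟩ :=
    exists_rescaling_formCongr_eq_uniformizer_pow_smul_one L v w hw hunr (placeForm_antidiagTwo_hermitian L v w hw)
      (det_placeForm_antidiagTwo_ne_zero_and_even L v w).1 (det_placeForm_antidiagTwo_ne_zero_and_even L v w).2 hγ hP hu hu1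
  refine ⟨e, he1, hpar, ?_⟩
  obtain ⟨σO, a₀, hσO', hσσ, ha₀, hq⟩ := exists_integer_involution_of_isUnramifiedIn L v w hw hunr
  have hϖv := Liu2021.LemD1IndexedNonVacuityInertCofinite.valued_toPlace_uniformizer_of_isUnramifiedIn L v hunr w
  have hϖ : IsUniformizingElement
      (toPlace v w (HeckeCharacter.uniformizer ↥(maximalRealSubfield L) v : v.adicCompletion ↥(maximalRealSubfield L))) :=
    isUniformizingElement_of_v_eq hϖv
  haveI : IsDiscreteValuationRing 𝒪[w.1.adicCompletion L] := isDiscreteValuationRing_integer_of_compatible hϖv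
  have hσϖ := galAdicCompletionMap_toPlace_self L v w hw (HeckeCharacter.uniformizer ↥(maximalRealSubfield L) v : v.adicCompletion _)
  have hval : ∀ i, valuation (w.1.adicCompletion L) (u i) = 1 := fun i => valuation_eq_one_of_galAdicCompletionMap_mul_self L v w hw (hu1 i)
  have hγ' := coe_inv_mul_mul_eq_of_eigenframe L v w hP hD
  rw [← zpow_natCast] at hform
  rw [ncard_selfDualStable_level_congr (galAdicCompletionMap (L := L) (IsCMField.complexConj L) hw) _ γ (P * D), hform]
  exact ncard_selfDualStable_smul_one_diag_level_self_eq_sum hϖ σO hσO' hσσ hσϖ he1 _ hγ' (hval 0) (hval 1) hN ha₀ hq i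

include hw in
/-- **THE SET OF `γ`-FIXED SELF-DUAL VERTICES AT `w` IS FINITE** (same frame; ★ FILE 3 `finite_selfDualStable_of_congr` + ★ FILE 2 `finite_selfDualStable_smul_one_diag`).
[cite: Kottwitz1988, §2] [cite: Flicker1998UnitaryFL, §6 p. 95] -/
theorem finite_selfDualStable_antidiagTwo_at (hunr : Algebra.IsUnramifiedIn (𝓞 L) v.asIdeal)
    {γ P : GL (Fin 2) (w.1.adicCompletion L)} {u : Fin 2 → w.1.adicCompletion L}
    (hγ : γ ∈ Literature.AlgebraicGeometry.ShimuraVarieties.unitaryGroup (galAdicCompletionMap (L := L) (IsCMField.complexConj L) hw)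
      (placeForm (Matrix.of fun i j : Fin 2 => if i.val + j.val + 1 = 2 then (1 : L) else 0) w.1))
    (hP : (γ : Matrix (Fin 2) (Fin 2) (w.1.adicCompletion L)) * P = P * diagonal u) (hu : Function.Injective u)
    (hu1 : ∀ i, galAdicCompletionMap (L := L) (IsCMField.complexConj L) hw (u i) * u i = 1) {N : ℕ}
    (hN : valuation (w.1.adicCompletion L) (u 0 - u 1) =
      valuation (w.1.adicCompletion L) (toPlace v w (HeckeCharacter.uniformizer ↥(maximalRealSubfield L) v : v.adicCompletion ↥(maximalRealSubfield L)) ^ N)) :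
    {Λ : Submodule 𝒪[w.1.adicCompletion L] (Fin 2 → w.1.adicCompletion L) |
        (∃ g : GL (Fin 2) (w.1.adicCompletion L),
          (∃ J' ∈ glInt 2 (w.1.adicCompletion L), (J' : Matrix (Fin 2) (Fin 2) (w.1.adicCompletion L)) =
            formCongr (galAdicCompletionMap (L := L) (IsCMField.complexConj L) hw) g
              (placeForm (Matrix.of fun i j : Fin 2 => if i.val + j.val + 1 = 2 then (1 : L) else 0) w.1)) ∧
          Λ = Submodule.span 𝒪[w.1.adicCompletion L] (Set.range ((g : Matrix (Fin 2) (Fin 2) (w.1.adicCompletion L)))ᵀ)) ∧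
        Λ.map ((Matrix.toLin' ((γ : GL (Fin 2) (w.1.adicCompletion L)) : Matrix (Fin 2) (Fin 2) (w.1.adicCompletion L))).restrictScalars
          𝒪[w.1.adicCompletion L]) = Λ}.Finite := by
  classical
  obtain ⟨c, D, e, hD, he1, -, hform⟩ :=
    exists_rescaling_formCongr_eq_uniformizer_pow_smul_one L v w hw hunr (placeForm_antidiagTwo_hermitian L v w hw)
      (det_placeForm_antidiagTwo_ne_zero_and_even L v w).1 (det_placeForm_antidiagTwo_ne_zero_and_even L v w).2 hγ hP hu hu1
  obtain ⟨σO, a₀, hσO', hσσ, ha₀, hq⟩ := exists_integer_involution_of_isUnramifiedIn L v w hw hunr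
  have hϖv := Liu2021.LemD1IndexedNonVacuityInertCofinite.valued_toPlace_uniformizer_of_isUnramifiedIn L v hunr w
  have hϖ : IsUniformizingElement
      (toPlace v w (HeckeCharacter.uniformizer ↥(maximalRealSubfield L) v : v.adicCompletion ↥(maximalRealSubfield L))) :=
    isUniformizingElement_of_v_eq hϖv
  haveI : IsDiscreteValuationRing 𝒪[w.1.adicCompletion L] := isDiscreteValuationRing_integer_of_compatible hϖv
  have hσϖ := galAdicCompletionMap_toPlace_self L v w hw (HeckeCharacter.uniformizer ↥(maximalRealSubfield L) v : v.adicCompletion _)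
  have hval : ∀ i, valuation (w.1.adicCompletion L) (u i) = 1 := fun i => valuation_eq_one_of_galAdicCompletionMap_mul_self L v w hw (hu1 i)
  have hγ' := coe_inv_mul_mul_eq_of_eigenframe L v w hP hD
  refine finite_selfDualStable_of_congr (galAdicCompletionMap (L := L) (IsCMField.complexConj L) hw) _ γ (P * D) ?_
  rw [← zpow_natCast] at hform
  rw [hform]
  exact finite_selfDualStable_smul_one_diag _ hϖ σO hσO' hσσ hσϖ he1 _ hγ' (hval 0) (hval 1) hN ha₀ hq

end SelfDual

/-! ## §3 The ϖ-modular (type `1 − e`) vertices: cumulative level counts at `w`, finiteness -/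

section Modular

include hw in
/-- **The rescaled form `ϖ_w⁻¹ • (Φ₂)_w`**: `σ_w`-hermitian, `det ≠ 0` of even order, with the same unitary group — the bookkeeping of ★ A-p03
`exists_ncard_modularStable_eq_smul_one`, exported. [cite: Kottwitz1988, §2] [cite: Jacobowitz1962, §7] -/
theorem inv_uniformizer_smul_placeForm_antidiagTwo_package (hunr : Algebra.IsUnramifiedIn (𝓞 L) v.asIdeal) :
    (((toPlace v w (HeckeCharacter.uniformizer ↥(maximalRealSubfield L) v : v.adicCompletion ↥(maximalRealSubfield L)))⁻¹ •
        placeForm (Matrix.of fun i j : Fin 2 => if i.val + j.val + 1 = 2 then (1 : L) else 0) w.1).map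
          (galAdicCompletionMap (L := L) (IsCMField.complexConj L) hw))ᵀ =
      (toPlace v w (HeckeCharacter.uniformizer ↥(maximalRealSubfield L) v : v.adicCompletion ↥(maximalRealSubfield L)))⁻¹ •
        placeForm (Matrix.of fun i j : Fin 2 => if i.val + j.val + 1 = 2 then (1 : L) else 0) w.1 ∧
    ((toPlace v w (HeckeCharacter.uniformizer ↥(maximalRealSubfield L) v : v.adicCompletion ↥(maximalRealSubfield L)))⁻¹ •
        placeForm (Matrix.of fun i j : Fin 2 => if i.val + j.val + 1 = 2 then (1 : L) else 0) w.1).det ≠ 0 ∧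
    Even (WithZero.log (Valued.v ((toPlace v w (HeckeCharacter.uniformizer ↥(maximalRealSubfield L) v : v.adicCompletion ↥(maximalRealSubfield L)))⁻¹ •
        placeForm (Matrix.of fun i j : Fin 2 => if i.val + j.val + 1 = 2 then (1 : L) else 0) w.1).det)) ∧
    ∀ γ : GL (Fin 2) (w.1.adicCompletion L),
      γ ∈ Literature.AlgebraicGeometry.ShimuraVarieties.unitaryGroup (galAdicCompletionMap (L := L) (IsCMField.complexConj L) hw)
        (placeForm (Matrix.of fun i j : Fin 2 => if i.val + j.val + 1 = 2 then (1 : L) else 0) w.1) →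
      γ ∈ Literature.AlgebraicGeometry.ShimuraVarieties.unitaryGroup (galAdicCompletionMap (L := L) (IsCMField.complexConj L) hw)
        ((toPlace v w (HeckeCharacter.uniformizer ↥(maximalRealSubfield L) v : v.adicCompletion ↥(maximalRealSubfield L)))⁻¹ •
          placeForm (Matrix.of fun i j : Fin 2 => if i.val + j.val + 1 = 2 then (1 : L) else 0) w.1) := by
  set σw := galAdicCompletionMap (L := L) (IsCMField.complexConj L) hw with hσw
  set ϖw : w.1.adicCompletion L :=
    toPlace v w (HeckeCharacter.uniformizer ↥(maximalRealSubfield L) v : v.adicCompletion ↥(maximalRealSubfield L)) with hϖw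
  set J := placeForm (Matrix.of fun i j : Fin 2 => if i.val + j.val + 1 = 2 then (1 : L) else 0) w.1 with hJdef
  have hJ : (J.map σw)ᵀ = J := placeForm_antidiagTwo_hermitian L v w hw
  have hJ0 : J.det ≠ 0 := (det_placeForm_antidiagTwo_ne_zero_and_even L v w).1
  have hJev : Even (WithZero.log (Valued.v J.det)) := (det_placeForm_antidiagTwo_ne_zero_and_even L v w).2
  have hϖ0 : ϖw ≠ 0 := toPlace_uniformizer_ne_zero L v w hunr
  have hσϖ : σw ϖw = ϖw := galAdicCompletionMap_toPlace_self L v w hw _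
  have hvϖinv : Valued.v ϖw⁻¹ = WithZero.exp (1 : ℤ) := by
    rw [map_inv₀, valued_toPlace_uniformizer L v w hunr, ← WithZero.exp_neg, neg_neg]
  refine ⟨?_, ?_, ?_, fun γ hγ => ?_⟩
  · conv_rhs => rw [← hJ]
    ext i j
    simp only [Matrix.transpose_apply, Matrix.map_apply, Matrix.smul_apply, smul_eq_mul, map_mul, map_inv₀, hσϖ]
  · rw [Matrix.det_smul, Fintype.card_fin]
    exact mul_ne_zero (pow_ne_zero _ (inv_ne_zero hϖ0)) hJ0
  · rw [Matrix.det_smul, Fintype.card_fin, map_mul, map_pow,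
      WithZero.log_mul (pow_ne_zero _ ((Valuation.ne_zero_iff _).2 (inv_ne_zero hϖ0))) ((Valuation.ne_zero_iff _).2 hJ0), WithZero.log_pow, hvϖinv,
      WithZero.log_exp]
    exact (even_two_mul (1 : ℤ)).add (by simpa using hJev)
  · show ((γ : Matrix (Fin 2) (Fin 2) (w.1.adicCompletion L)).map σw)ᵀ * (ϖw⁻¹ • J) * γ = ϖw⁻¹ • J
    have h : ((γ : Matrix (Fin 2) (Fin 2) (w.1.adicCompletion L)).map σw)ᵀ * J * γ = J := hγ
    rw [Matrix.mul_smul, Matrix.smul_mul, h]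

set_option maxHeartbeats 400000 in
include hw in
/-- **CUMULATIVE LEVEL-`i` COUNT OF THE `γ`-FIXED ϖ-MODULAR VERTICES AT `w`**: with the setting of §2 there is `e ∈ {0,1}` with `Even (log |⟨p₀,p₀⟩|) ↔ e = 1` (the parity
bit of ★ A-p03 `exists_ncard_modularStable_eq_smul_one`) and `#{Λ ∈ M((Φ₂)_w, γ) | (γ − u₁·1)Λ ≤ ϖ_w^iΛ} = Σ_{j ≤ N, j ≡ e (2), j + i ≤ N} w(q_v, j)` —
`M((Φ₂)_w) = S(ϖ_w⁻¹(Φ₂)_w)` under the level conjunct (★ FILE 2 `setOf_modularStable_and_eq_selfDualStable_and`), ★ (L5-d1) frame for the rescaled form, ★ FILE 2 transport,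
★ FILE 1 count; the parity flips as in A-p03's proof (`⟨p₀,p₀⟩_{ϖ⁻¹J} = ϖ⁻¹⟨p₀,p₀⟩_J`).  On the tree: the type-`1−e` vertices of the fixed ball at depth `≥ i`.
[cite: Kottwitz1988, §2] [cite: Flicker1998UnitaryFL, §6 p. 95 REMARK] [cite: Rogawski1990, §4.9 Lemma 4.9.3 p. 61] -/
theorem exists_ncard_modularStable_antidiagTwo_level_eq_sum_at (hunr : Algebra.IsUnramifiedIn (𝓞 L) v.asIdeal)
    {γ P : GL (Fin 2) (w.1.adicCompletion L)} {u : Fin 2 → w.1.adicCompletion L}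
    (hγ : γ ∈ Literature.AlgebraicGeometry.ShimuraVarieties.unitaryGroup (galAdicCompletionMap (L := L) (IsCMField.complexConj L) hw)
      (placeForm (Matrix.of fun i j : Fin 2 => if i.val + j.val + 1 = 2 then (1 : L) else 0) w.1))
    (hP : (γ : Matrix (Fin 2) (Fin 2) (w.1.adicCompletion L)) * P = P * diagonal u) (hu : Function.Injective u)
    (hu1 : ∀ i, galAdicCompletionMap (L := L) (IsCMField.complexConj L) hw (u i) * u i = 1) {N : ℕ}
    (hN : valuation (w.1.adicCompletion L) (u 0 - u 1) =
      valuation (w.1.adicCompletion L) (toPlace v w (HeckeCharacter.uniformizer ↥(maximalRealSubfield L) v : v.adicCompletion ↥(maximalRealSubfield L)) ^ N))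
    (i : ℕ) :
    ∃ e : ℕ, e ≤ 1 ∧
      (Even (WithZero.log (Valued.v (twistGram (galAdicCompletionMap (L := L) (IsCMField.complexConj L) hw)
        (placeForm (Matrix.of fun i j : Fin 2 => if i.val + j.val + 1 = 2 then (1 : L) else 0) w.1) P.val 0 0))) ↔ e = 1) ∧
      {Λ : Submodule 𝒪[w.1.adicCompletion L] (Fin 2 → w.1.adicCompletion L) |
          ((∃ g : GL (Fin 2) (w.1.adicCompletion L),
            (∃ J' ∈ glInt 2 (w.1.adicCompletion L),
              (toPlace v w (HeckeCharacter.uniformizer ↥(maximalRealSubfield L) v : v.adicCompletion ↥(maximalRealSubfield L))) •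
                  (J' : Matrix (Fin 2) (Fin 2) (w.1.adicCompletion L)) =
                formCongr (galAdicCompletionMap (L := L) (IsCMField.complexConj L) hw) g
                  (placeForm (Matrix.of fun i j : Fin 2 => if i.val + j.val + 1 = 2 then (1 : L) else 0) w.1)) ∧
            Λ = Submodule.span 𝒪[w.1.adicCompletion L] (Set.range ((g : Matrix (Fin 2) (Fin 2) (w.1.adicCompletion L)))ᵀ)) ∧
          Λ.map ((Matrix.toLin' ((γ : GL (Fin 2) (w.1.adicCompletion L)) : Matrix (Fin 2) (Fin 2) (w.1.adicCompletion L))).restrictScalars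
            𝒪[w.1.adicCompletion L]) = Λ) ∧
          Λ.map ((Matrix.toLin' (((γ : GL (Fin 2) (w.1.adicCompletion L)) : Matrix (Fin 2) (Fin 2) (w.1.adicCompletion L)) -
              u 1 • (1 : Matrix (Fin 2) (Fin 2) (w.1.adicCompletion L)))).restrictScalars 𝒪[w.1.adicCompletion L]) ≤
            Λ.map ((Matrix.toLin' (toPlace v w (HeckeCharacter.uniformizer ↥(maximalRealSubfield L) v : v.adicCompletion ↥(maximalRealSubfield L)) ^ i •
              (1 : Matrix (Fin 2) (Fin 2) (w.1.adicCompletion L)))).restrictScalars 𝒪[w.1.adicCompletion L])}.ncard =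
      ∑ j ∈ (range (N + 1)).filter (fun j => j % 2 = e ∧ j + i ≤ N),
        (if j = 0 then 1 else Nat.card (𝓞 ↥(maximalRealSubfield L) ⧸ v.asIdeal) ^ (j - 1) * (Nat.card (𝓞 ↥(maximalRealSubfield L) ⧸ v.asIdeal) + 1)) := by
  classical
  have hϖ0 := toPlace_uniformizer_ne_zero L v w hunr
  obtain ⟨hJ', hJ'0, hJ'ev, hU⟩ := inv_uniformizer_smul_placeForm_antidiagTwo_package L v w hw hunr
  obtain ⟨c, D, e, hD, he1, hpar, hform⟩ :=
    exists_rescaling_formCongr_eq_uniformizer_pow_smul_one L v w hw hunr hJ' hJ'0 hJ'ev (hU γ hγ) hP hu hu1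
  obtain ⟨σO, a₀, hσO', hσσ, ha₀, hq⟩ := exists_integer_involution_of_isUnramifiedIn L v w hw hunr
  have hϖv := Liu2021.LemD1IndexedNonVacuityInertCofinite.valued_toPlace_uniformizer_of_isUnramifiedIn L v hunr w
  have hϖ : IsUniformizingElement
      (toPlace v w (HeckeCharacter.uniformizer ↥(maximalRealSubfield L) v : v.adicCompletion ↥(maximalRealSubfield L))) :=
    isUniformizingElement_of_v_eq hϖv
  haveI : IsDiscreteValuationRing 𝒪[w.1.adicCompletion L] := isDiscreteValuationRing_integer_of_compatible hϖv
  have hσϖ := galAdicCompletionMap_toPlace_self L v w hw (HeckeCharacter.uniformizer ↥(maximalRealSubfield L) v : v.adicCompletion _)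
  have hval : ∀ i, valuation (w.1.adicCompletion L) (u i) = 1 := fun i => valuation_eq_one_of_galAdicCompletionMap_mul_self L v w hw (hu1 i)
  have hγ' := coe_inv_mul_mul_eq_of_eigenframe L v w hP hD
  refine ⟨e, he1, ?_, ?_⟩
  · -- the parity bit flips: `⟨p₀,p₀⟩_{ϖ⁻¹J} = ϖ⁻¹ ⟨p₀,p₀⟩_J`
    have hvϖinv : Valued.v (toPlace v w (HeckeCharacter.uniformizer ↥(maximalRealSubfield L) v : v.adicCompletion ↥(maximalRealSubfield L)))⁻¹ =
        WithZero.exp (1 : ℤ) := by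
      rw [map_inv₀, valued_toPlace_uniformizer L v w hunr, ← WithZero.exp_neg, neg_neg]
    have htw : twistGram (galAdicCompletionMap (L := L) (IsCMField.complexConj L) hw)
        ((toPlace v w (HeckeCharacter.uniformizer ↥(maximalRealSubfield L) v : v.adicCompletion ↥(maximalRealSubfield L)))⁻¹ •
          placeForm (Matrix.of fun i j : Fin 2 => if i.val + j.val + 1 = 2 then (1 : L) else 0) w.1) P.val 0 0 =
        (toPlace v w (HeckeCharacter.uniformizer ↥(maximalRealSubfield L) v : v.adicCompletion ↥(maximalRealSubfield L)))⁻¹ *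
          twistGram (galAdicCompletionMap (L := L) (IsCMField.complexConj L) hw)
            (placeForm (Matrix.of fun i j : Fin 2 => if i.val + j.val + 1 = 2 then (1 : L) else 0) w.1) P.val 0 0 := by
      simp only [twistGram_def, Matrix.mul_smul, Matrix.smul_mul, Matrix.smul_apply, smul_eq_mul]
    have hx0 := twistGram_eigenframe_apply_ne_zero (galAdicCompletionMap (L := L) (IsCMField.complexConj L) hw) _
      (det_placeForm_antidiagTwo_ne_zero_and_even L v w).1 hγ hP hu hu1 0
    rw [htw, map_mul, WithZero.log_mul ((Valuation.ne_zero_iff _).2 (inv_ne_zero hϖ0)) ((Valuation.ne_zero_iff _).2 hx0), hvϖinv, WithZero.log_exp,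
      add_comm, Int.even_add_one] at hpar
    rcases Nat.le_one_iff_eq_zero_or_eq_one.1 he1 with rfl | rfl
    · exact ⟨fun h => ((hpar.2 rfl) h).elim, fun h => absurd h zero_ne_one⟩
    · exact ⟨fun _ => rfl, fun _ => not_not.1 fun hn => absurd (hpar.1 hn) one_ne_zero⟩
  · rw [← zpow_natCast] at hform
    exact ncard_modularStable_level_eq_sum_of_frame _ hϖ σO hσO' hσσ hσϖ he1 _ γ (P * D) hγ' (hval 0) (hval 1) hN ha₀ hq hform i

include hw in
/-- **THE SET OF `γ`-FIXED ϖ-MODULAR VERTICES AT `w` IS FINITE** (`M = S(ϖ⁻¹J)`, ★ FILE 3 `finite_selfDualStable_of_congr`, ★ FILE 2 `finite_selfDualStable_smul_one_diag`).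
[cite: Kottwitz1988, §2] -/
theorem finite_modularStable_antidiagTwo_at (hunr : Algebra.IsUnramifiedIn (𝓞 L) v.asIdeal)
    {γ P : GL (Fin 2) (w.1.adicCompletion L)} {u : Fin 2 → w.1.adicCompletion L}
    (hγ : γ ∈ Literature.AlgebraicGeometry.ShimuraVarieties.unitaryGroup (galAdicCompletionMap (L := L) (IsCMField.complexConj L) hw)
      (placeForm (Matrix.of fun i j : Fin 2 => if i.val + j.val + 1 = 2 then (1 : L) else 0) w.1))
    (hP : (γ : Matrix (Fin 2) (Fin 2) (w.1.adicCompletion L)) * P = P * diagonal u) (hu : Function.Injective u)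
    (hu1 : ∀ i, galAdicCompletionMap (L := L) (IsCMField.complexConj L) hw (u i) * u i = 1) {N : ℕ}
    (hN : valuation (w.1.adicCompletion L) (u 0 - u 1) =
      valuation (w.1.adicCompletion L) (toPlace v w (HeckeCharacter.uniformizer ↥(maximalRealSubfield L) v : v.adicCompletion ↥(maximalRealSubfield L)) ^ N)) :
    {Λ : Submodule 𝒪[w.1.adicCompletion L] (Fin 2 → w.1.adicCompletion L) |
        (∃ g : GL (Fin 2) (w.1.adicCompletion L),
          (∃ J' ∈ glInt 2 (w.1.adicCompletion L),
            (toPlace v w (HeckeCharacter.uniformizer ↥(maximalRealSubfield L) v : v.adicCompletion ↥(maximalRealSubfield L))) •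
                (J' : Matrix (Fin 2) (Fin 2) (w.1.adicCompletion L)) =
              formCongr (galAdicCompletionMap (L := L) (IsCMField.complexConj L) hw) g
                (placeForm (Matrix.of fun i j : Fin 2 => if i.val + j.val + 1 = 2 then (1 : L) else 0) w.1)) ∧
          Λ = Submodule.span 𝒪[w.1.adicCompletion L] (Set.range ((g : Matrix (Fin 2) (Fin 2) (w.1.adicCompletion L)))ᵀ)) ∧
        Λ.map ((Matrix.toLin' ((γ : GL (Fin 2) (w.1.adicCompletion L)) : Matrix (Fin 2) (Fin 2) (w.1.adicCompletion L))).restrictScalars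
          𝒪[w.1.adicCompletion L]) = Λ}.Finite := by
  classical
  obtain ⟨hJ', hJ'0, hJ'ev, hU⟩ := inv_uniformizer_smul_placeForm_antidiagTwo_package L v w hw hunr
  obtain ⟨c, D, e, hD, he1, -, hform⟩ :=
    exists_rescaling_formCongr_eq_uniformizer_pow_smul_one L v w hw hunr hJ' hJ'0 hJ'ev (hU γ hγ) hP hu hu1
  obtain ⟨σO, a₀, hσO', hσσ, ha₀, hq⟩ := exists_integer_involution_of_isUnramifiedIn L v w hw hunr
  have hϖv := Liu2021.LemD1IndexedNonVacuityInertCofinite.valued_toPlace_uniformizer_of_isUnramifiedIn L v hunr w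
  have hϖ : IsUniformizingElement
      (toPlace v w (HeckeCharacter.uniformizer ↥(maximalRealSubfield L) v : v.adicCompletion ↥(maximalRealSubfield L))) :=
    isUniformizingElement_of_v_eq hϖv
  haveI : IsDiscreteValuationRing 𝒪[w.1.adicCompletion L] := isDiscreteValuationRing_integer_of_compatible hϖv
  have hσϖ := galAdicCompletionMap_toPlace_self L v w hw (HeckeCharacter.uniformizer ↥(maximalRealSubfield L) v : v.adicCompletion _)
  have hval : ∀ i, valuation (w.1.adicCompletion L) (u i) = 1 := fun i => valuation_eq_one_of_galAdicCompletionMap_mul_self L v w hw (hu1 i)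
  have hγ' := coe_inv_mul_mul_eq_of_eigenframe L v w hP hD
  rw [← zpow_natCast] at hform
  exact finite_modularStable_of_frame _ hϖ σO hσO' hσσ hσϖ he1 _ γ (P * D) hγ' (hval 0) (hval 1) hN ha₀ hq hform

end Modular

end Literature.NumberTheory.Automorphic.UnitaryGroup

end
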